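import Summits.Ventures.PercRepro.RankLevelSetExplicitLin2KeyL

/-!
# PercRepro — THE LEVEL-16 THEOREM-M ROW OF C-025 OVER THE 5/8 RANGE: THE KEY AT `p = 41 686` (p9, S4; the key is p4's)

`proofs/SUBCLAIM-S4-p9.md` §S4.2⁗⁗. p4's THEOREM-M key `KeyL 16 p d` (RankLevelSetExplicitLin2KeyL) checked by the kernel at
`p = 41 686` on the coranks `17 ≤ d ≤ 40976` of THE 5/8 RANGE (`D' = 16 + 5·2^{13} = 40976`; the large-corank theorem
`c025_core_explicit_large_of58` takes the coranks beyond): `41 686` = the least `p` with the optimal Chernoff pair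
`16·n^n ≤ 2^n·(n − K)^{n−K}·K^K` at `n = p + D'`, `K = 16 + D'` (twin lean-drafts/p9/g7/twin/range58.py), at or above the key's
own floor and the bases `N₁ = 41 196`, `P₂ = 41 010` (RankLevelSetExplicitLin2Bases58); p4's sharp row sits at `66 440`
(RankLevelSetExplicitLin2IndepFloorS). The level step and the unconditional chain are RankLevelSetExplicitLin2IndepFloor58.
Axioms: standard (kernel `decide`).
-/
-- part A: chunks 1 … 8 of 20

namespace PercRepro

namespace ThmN

namespace Explicit

/-- The THEOREM-M key row at `(q, p) = (16, 41 686)`, chunk 1 of 20: coranks `17 … 2064`, by the kernel. -/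
theorem key_sixteen_indep58_row_1 : ∀ t < 2048, KeyL 16 41686 (17 + t) := by decide +kernel

/-- The THEOREM-M key row at `(q, p) = (16, 41 686)`, chunk 2 of 20: coranks `2065 … 4112`, by the kernel. -/
theorem key_sixteen_indep58_row_2 : ∀ t < 2048, KeyL 16 41686 (17 + (2048 + t)) := by decide +kernel

/-- The THEOREM-M key row at `(q, p) = (16, 41 686)`, chunk 3 of 20: coranks `4113 … 6160`, by the kernel. -/
theorem key_sixteen_indep58_row_3 : ∀ t < 2048, KeyL 16 41686 (17 + (4096 + t)) := by decide +kernel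

/-- The THEOREM-M key row at `(q, p) = (16, 41 686)`, chunk 4 of 20: coranks `6161 … 8208`, by the kernel. -/
theorem key_sixteen_indep58_row_4 : ∀ t < 2048, KeyL 16 41686 (17 + (6144 + t)) := by decide +kernel

/-- The THEOREM-M key row at `(q, p) = (16, 41 686)`, chunk 5 of 20: coranks `8209 … 10256`, by the kernel. -/
theorem key_sixteen_indep58_row_5 : ∀ t < 2048, KeyL 16 41686 (17 + (8192 + t)) := by decide +kernel

/-- The THEOREM-M key row at `(q, p) = (16, 41 686)`, chunk 6 of 20: coranks `10257 … 12304`, by the kernel. -/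
theorem key_sixteen_indep58_row_6 : ∀ t < 2048, KeyL 16 41686 (17 + (10240 + t)) := by decide +kernel

/-- The THEOREM-M key row at `(q, p) = (16, 41 686)`, chunk 7 of 20: coranks `12305 … 14352`, by the kernel. -/
theorem key_sixteen_indep58_row_7 : ∀ t < 2048, KeyL 16 41686 (17 + (12288 + t)) := by decide +kernel

/-- The THEOREM-M key row at `(q, p) = (16, 41 686)`, chunk 8 of 20: coranks `14353 … 16400`, by the kernel. -/
theorem key_sixteen_indep58_row_8 : ∀ t < 2048, KeyL 16 41686 (17 + (14336 + t)) := by decide +kernel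

end Explicit

end ThmN

end PercRepro
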